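import Summits.ABC.IUTFork.Thm311RealInd1StripTraceRigid
import HarnessLib

/-!
# [IUTchIII] Thm 3.11 (i) (Ind1) at `v ∈ 𝕍^non`: Kondo's Theorem 2.3 for `[K_v : ℚ_p]` ODD — the Jannsen–Wingberg planes SPAN the
# trace-zero hyperplane `Ker(Tr_{K_v/ℚ_p})` (modulo the group-level Jannsen–Wingberg fact)

PROOF-ONLY file (abc-iut cell, Cor. 3.12 sub-crew, seat abc-iut-c312-1 = holder of record of the typed [IUTchIII] Thm. 3.11,
gen 11; row «R13 TRACE-RIGIDITY», part e).  TAKES NO SIDE on [IUTchIII] Cor. 3.12.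

K. Kondo, arXiv:2512.09231 Thm. 2.3: for `p_k` odd and `d_k ≥ 2`, `Ker(Tr_{k/ℚ_p}) = ⟨y_2, y_3, …, y_{d_k}⟩_{ℚ_p}` if `d_k` is odd
(resp. `⟨y_1, y_3, …, y_{d_k}⟩` if `d_k` is even).  For `d_k` ODD the right-hand side is exactly the span of the `2g = d_k − 1` plane
vectors `a_i, b_i` (`c = 1`); `Thm311RealInd1StripTraceRigid` proved `⊆` (every plane vector is trace-zero, by trace rigidity of the
realised twists); here the EQUALITY, by dimension: the plane vectors are linearly independent (Kronecker dualities `ca, cb`) and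
`dim Ker(Tr) = d − 1` (`Tr(p^0) = d ≠ 0`).
* `Real.linearIndependent_planes` — `2g` vectors with a Kronecker-dual family of functionals are linearly independent.
* **`Real.span_planes_eq_ker_trace_of_jannsenWingberg_odd_deg`** — assuming `JannsenWingbergTwists`, at `v ∣ p` odd with `[K_v : ℚ_p] ≥ 3`
  ODD: the realised planes of `exists_realised_planes_trace_zero_of_jannsenWingberg` satisfy
  `span_{ℚ_p}{ya i, yb i} = Ker(Tr_{K_v/ℚ_p})` (in `K_v^{(1/n_v)}`) — so the realised (Ind1)-strip transvections `x ↦ x + cb i x • ya i`,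
  `x ↦ x − ca i x • yb i` shear along a BASIS of the trace-zero hyperplane.  (For `d` even print's right-hand side contains `y_1`, reached by
  the plane-`0` twist `x_2 ↦ x_2 x_1` which the group-level fact does not record; only `⊆` is available there.)
HONEST SCOPE: conditional on `hJW`; statements about OUR typed objects at ONE place; nothing here asserts or refutes [IUTchIII] Cor. 3.12.
[claim: Mochizuki2012, status: disputed]; [cite: Kondo2025OuterAutMLF, §2 Thm 2.3 p.9]; [cite: HoshiNishio2022OuterAutMLF, Lemma 1.3 and Lemma 2.3 (ii)].
typed ≠ proved; a conditional theorem discharges nothing it binds.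
-/

set_option autoImplicit false

noncomputable section

open Metric Set
open scoped Pointwise

namespace Summit.ABC.IUTFork.Thm311.Real

open NumberField IsDedekindDomain Literature.NumberTheory.NumberFields Literature.IUT.LogVolume
open Literature.NumberTheory.GaloisRepresentations Literature.NumberTheory.GaloisRepresentations.Ultrametric
open Literature.AnabelianGeometry.AbsoluteAnabelian Literature.IUT.HodgeArakelov
open Literature.IUT.HodgeArakelov.AbsTopMonoids

variable {F : Type} [Field F] [NumberField F] (v : HeightOneSpectrum (𝓞 F))

/-- **Kronecker-dual families are linearly independent**: vectors `ya i, yb i` (`i : Fin g`) of a `K`-module admitting functionals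
`ca i, cb i` with `ca i (ya j) = δ_{ij}`, `cb i (yb j) = δ_{ij}`, `ca i (yb j) = 0`, `cb i (ya j) = 0` form a linearly independent family
indexed by `Fin g ⊕ Fin g`. [folklore] -/
theorem linearIndependent_planes {K V : Type*} [Field K] [AddCommGroup V] [Module K V] {g : ℕ}
    (ca cb : Fin g → (V →ₗ[K] K)) (ya yb : Fin g → V)
    (haa : ∀ i j, ca i (ya j) = if i = j then 1 else 0) (hbb : ∀ i j, cb i (yb j) = if i = j then 1 else 0)
    (hab : ∀ i j, ca i (yb j) = 0) (hba : ∀ i j, cb i (ya j) = 0) :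
    LinearIndependent K (Sum.elim ya yb) := by
  rw [Fintype.linearIndependent_iff]
  intro f hf
  have hsum : ∑ i : Fin g, f (Sum.inl i) • ya i + ∑ i : Fin g, f (Sum.inr i) • yb i = 0 := by
    rw [Fintype.sum_sum_type] at hf
    simpa only [Sum.elim_inl, Sum.elim_inr] using hf
  rintro (j | j)
  · have h := congrArg (ca j) hsum
    rw [map_add, map_sum, map_sum, map_zero] at h
    simp only [map_smul, haa, hab, smul_eq_mul, mul_ite, mul_one, mul_zero, Finset.sum_ite_eq, Finset.mem_univ, if_true,
      Finset.sum_const_zero, add_zero] at h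
    exact h
  · have h := congrArg (cb j) hsum
    rw [map_add, map_sum, map_sum, map_zero] at h
    simp only [map_smul, hbb, hba, smul_eq_mul, mul_ite, mul_one, mul_zero, Finset.sum_ite_eq, Finset.mem_univ, if_true,
      Finset.sum_const_zero, zero_add] at h
    exact h

/-- **KONDO'S THEOREM 2.3 FOR `[K_v : ℚ_p]` ODD, from the group-level Jannsen–Wingberg fact.**  Assume `JannsenWingbergTwists`.  At a
finite place `v ∣ p` of a number field `F` with `p` odd and `d = [K_v : ℚ_p] ≥ 3` ODD, there are Jannsen–Wingberg plane data as in
`exists_realised_planes_trace_zero_of_jannsenWingberg` — `c ≤ 2`, `g`, `d = c + 2g`, Kronecker-dual `(ca, cb; ya, yb)` over `ℚ_p` in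
`K_v^{(1/n_v)}`, `ψ i, ψ' i ∈ Real.ind1StripOf v (Real.galoisLog v)` realising the transvections — with, MOREOVER,
`span_{ℚ_p} {ya i, yb i : i} = Ker(Tr_{K_v/ℚ_p})`: the plane vectors are trace-zero (trace rigidity), linearly independent (`2g` of them),
and `dim Ker(Tr) = d − 1 = 2g` (`c = 1` for `d` odd; `Tr 1 = d ≠ 0`).  [claim: Mochizuki2012, status: disputed]
[cite: Kondo2025OuterAutMLF, §2 Thm 2.3 p.9] [cite: HoshiNishio2022OuterAutMLF, Lemma 2.3 (ii) p.7] -/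
theorem span_planes_eq_ker_trace_of_jannsenWingberg_odd_deg (hJW : JannsenWingbergTwists)
    (p : ℕ) [Fact p.Prime] (hv : ((p : ℕ) : 𝓞 F) ∈ v.asIdeal) (hp2 : p ≠ 2) (h3 : 3 ≤ localDeg F v) (hodd : Odd (localDeg F v)) :
    ∃ (c g : ℕ) (_ : c ≤ 2) (_ : localDeg F v = c + 2 * g)
      (ca cb : Fin g → (RescaledCompletion F p v hv →ₗ[ℚ_[p]] ℚ_[p])) (ya yb : Fin g → RescaledCompletion F p v hv)
      (ψ ψ' : Fin g → (v.adicCompletion F ≃+ v.adicCompletion F)),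
      (∀ i j, ca i (ya j) = if i = j then 1 else 0) ∧ (∀ i j, cb i (yb j) = if i = j then 1 else 0) ∧
      (∀ i j, ca i (yb j) = 0) ∧ (∀ i j, cb i (ya j) = 0) ∧
      (∀ i, ψ i ∈ ind1StripOf v (galoisLog v)) ∧ (∀ i, ψ' i ∈ ind1StripOf v (galoisLog v)) ∧
      (∀ i (x : RescaledCompletion F p v hv),
        RescaledCompletion.of F p v hv (ψ i ((RescaledCompletion.of F p v hv).symm x)) = x + cb i x • ya i) ∧
      (∀ i (x : RescaledCompletion F p v hv),
        RescaledCompletion.of F p v hv (ψ' i ((RescaledCompletion.of F p v hv).symm x)) = x - ca i x • yb i) ∧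
      Submodule.span ℚ_[p] (Set.range ya ∪ Set.range yb) =
        LinearMap.ker (Algebra.trace ℚ_[p] (RescaledCompletion F p v hv)) := by
  obtain ⟨c, g, hc, hcard, ca, cb, ya, yb, ψ, ψ', haa, hbb, hab, hba, hψ, hψ', hT, hT', hta, htb⟩ :=
    exists_realised_planes_trace_zero_of_jannsenWingberg v hJW p hv hp2 h3
  refine ⟨c, g, hc, hcard, ca, cb, ya, yb, ψ, ψ', haa, hbb, hab, hba, hψ, hψ', hT, hT', ?_⟩
  haveI : FiniteDimensional ℚ_[p] (RescaledCompletion F p v hv) := FiniteDimensional.of_locallyCompactSpace ℚ_[p]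
  set Tr := Algebra.trace ℚ_[p] (RescaledCompletion F p v hv) with hTr
  -- `c = 1`: `d = c + 2g` is odd and `c ≤ 2`
  have hc1 : c = 1 := by obtain ⟨m, hm⟩ := hodd; omega
  have hfin : Module.finrank ℚ_[p] (RescaledCompletion F p v hv) = localDeg F v :=
    (RescaledCompletion.localDeg_eq_finrank F p v hv).symm
  -- `⊆`: the plane vectors are trace-zero
  have hle : Submodule.span ℚ_[p] (Set.range ya ∪ Set.range yb) ≤ LinearMap.ker Tr := by
    rw [Submodule.span_le]
    rintro _ (⟨i, rfl⟩ | ⟨i, rfl⟩)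
    · exact (LinearMap.mem_ker).mpr (hta i)
    · exact (LinearMap.mem_ker).mpr (htb i)
  -- the span has dimension `2g`
  have hli : LinearIndependent ℚ_[p] (Sum.elim ya yb) := linearIndependent_planes ca cb ya yb haa hbb hab hba
  have hspan : Module.finrank ℚ_[p] (Submodule.span ℚ_[p] (Set.range ya ∪ Set.range yb)) = 2 * g := by
    rw [← Set.Sum.elim_range, finrank_span_eq_card hli, Fintype.card_sum, Fintype.card_fin]
    ring
  -- `Tr` is onto `ℚ_p` (`Tr 1 = d ≠ 0`), so `dim Ker(Tr) = d − 1`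
  have hTr1 : Tr 1 ≠ 0 := by
    rw [hTr, ← map_one (algebraMap ℚ_[p] (RescaledCompletion F p v hv)), Algebra.trace_algebraMap, hfin, nsmul_eq_mul, mul_one]
    exact_mod_cast (show localDeg F v ≠ 0 by omega)
  have hrange : LinearMap.range Tr = ⊤ := by
    rw [eq_top_iff]
    intro t _
    refine ⟨(t / Tr 1) • (1 : RescaledCompletion F p v hv), ?_⟩
    rw [map_smul, smul_eq_mul, div_mul_cancel₀ t hTr1]
  have hker : Module.finrank ℚ_[p] (LinearMap.ker Tr) = 2 * g := by
    have h := LinearMap.finrank_range_add_finrank_ker Tr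
    rw [hrange, finrank_top, Module.finrank_self, hfin, hcard, hc1] at h
    omega
  exact Submodule.eq_of_le_of_finrank_eq hle (by rw [hspan, hker])

end Summit.ABC.IUTFork.Thm311.Real

end
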